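import Summits.QuantumFields.YangMills.Theorems.BalabanLadderUVSeamRecColdWallDirichletRatePolyWindow
import Summits.QuantumFields.YangMills.Theorems.WeakCouplingRatesCurvatureKernel
import HarnessLib

/-!
# Crux `UVSeamRec` (stmt-QuantumFields-20043), line «coldwall_pure»: THE COLD-WALL CENTRE DEFICIT IS THE PERTURBATIVE `3/(4β)` —
# `|β · kerE^𝟙_{β,(x−R−1,2R+3)}(2 − plane q x) − 3/4| ≤ β^{−θ} + K/R⁴` on the whole polynomial window `1 ≤ R`, `R + 1 ≤ ⌈β^{1/100}⌉`

Helper file (`--supports stmt-QuantumFields-20043`) of the LEAD seat `ym-spine-20043-p1` (gen 14); sequel of `…ColdWallDirichletRatePolyWindow`.  The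
coincident value of the `ℤ⁴` lattice-Maxwell curvature kernel is the NUMBER `V_∞(q) = 1/2` for every plane (Literature `curvatureTwoPoint_self`:
`2/d` at `d = 4`, through the route `WeakCouplingRates`' identification `curvatureTwoPoint_eq_curl_greenTensor`).  Substituting it:
* `curl_greenTensor_self_eq_half` — `(d₁ div₂ g_{(0;q)})(0;q) = 1/2`;
* **`kerE_one_deficit_threeQuarters_polyWindow`** — for `0 < θ ≤ 1/100` there are `K ≥ 0` and `β₀` with, for all `β ≥ β₀`, `1 ≤ R`, `R + 1 ≤ ⌈β^θ⌉`, `q.1 < q.2`, `x`: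
  `|β · kerE^𝟙_{β,(x−R−1,2R+3)}(2 − plane q x) − 3/4| ≤ β^{−θ} + K/R⁴` — the cold-wall centre deficit in tree units IS the one-loop value `3/(4β)` (lattice
  perturbation theory: `(N²−1)/(4β) · ½·…`; cf. gens 10–12 of this lineage: thermal FLOOR `6/(24β+3) ≈ 1/(4β)` for every exterior, torus CEILING `29/β`,
  box-average ceiling `92/β`, and «perturbation theory `3/(4β)`» quoted as the target), up to the one-scale error `β^{−1−θ}` and the conducting-cavity
  finite-size law `K/(βR⁴)`;
* `dirichletRate_polyWindow_threeQuarters` — (DR) on the polynomial window with the PLANE-INDEPENDENT explicit reference `p(β) = 2 − 3/(4·max β 1)`.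
HONEST FRAMING: a numerical identification on top of p625296; the femto tail of (DR) and (CW)/(GD)/floors are untouched; YM mass gap NOT proved; not Clay.
-/

set_option autoImplicit false

noncomputable section

open MeasureTheory Finset Filter Topology
open Literature.Probability.LatticeModels (Site)
open Literature.MathematicalPhysics.QuantumLattice
open Literature.MathematicalPhysics.QuantumFieldTheory
open Literature.MathematicalPhysics.QuantumFieldTheory.LatticeMaxwell
open Literature.MathematicalPhysics.QuantumFieldTheory.AxialGauge
open Literature.MathematicalPhysics.QuantumFieldTheory.LatticeForm (d₁ d₂)
open Literature.MathematicalPhysics.QuantumFieldTheory.LatticeChain (div₂)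
open Summit.QuantumFields.YangMills.Theorems.WeakCouplingRates
open Summit.QuantumFields.YangMills.Cruxes.OSLegsFromFemtoAndGap.DlrCollarTransfer (cubeSites cubeEdges kerE plane continuous_plane)

namespace Summit.QuantumFields.YangMills.Cruxes.UVSeamRec.ClassicalResponse.ColdWall

/-- **The coincident value of the `ℤ⁴` curvature kernel is `1/2`** in every plane: `(d₁ div₂ g_{(0;i,j)})(0;i,j) = curvatureTwoPoint p p = 2/4`.
[folklore] -/
theorem curl_greenTensor_self_eq_half (q : Fin 4 × Fin 4) (hq : q.1 < q.2) :
    d₁ (div₂ (greenTensor (((0 : Site 4), q.1, q.2) : Plaq 4))) 0 q.1 q.2 = 1 / 2 := by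
  have h := curvatureTwoPoint_eq_curl_greenTensor (((0 : Site 4), ⟨(q.1, q.2), hq⟩) : ZdPlaquette 4) (((0 : Site 4), ⟨(q.1, q.2), hq⟩) : ZdPlaquette 4)
  rw [curvatureTwoPoint_self (by norm_num : 3 ≤ 4)] at h
  simp only at h
  rw [← h]; norm_num

/-- `R⁴ · |C_{D,R+1}(centre, q) − 1/2| ≤ K` for every `R` and plane. [folklore] -/
theorem pow_four_mul_abs_boxDirProjKernel_centre_sub_half_le :
    ∃ K : ℝ, 0 ≤ K ∧ ∀ (R : ℕ) (q : Fin 4 × Fin 4), q.1 < q.2 →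
      (R : ℝ) ^ 4 * |boxDirProjKernel (R + 1) ((fun _ : Fin 4 => (R : ℤ) + 1), q.1, q.2) ((fun _ : Fin 4 => (R : ℤ) + 1), q.1, q.2) - 1 / 2| ≤ K := by
  obtain ⟨K, hK0, hK⟩ := pow_four_mul_abs_boxDirProjKernel_centre_sub_le
  refine ⟨K + 31 ^ 4 * (1 + 1 / 2), by positivity, fun R q hq => ?_⟩
  have h := hK R q hq
  rw [curl_greenTensor_self_eq_half q hq] at h
  rw [abs_of_pos (by norm_num : (0 : ℝ) < 1 / 2)] at h
  exact h

/-- **THE COLD-WALL CENTRE DEFICIT IS `3/(4β)` ON THE POLYNOMIAL WINDOW.**  For `0 < θ ≤ 1/100` there are `K ≥ 0` and `β₀` such that for all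
`β ≥ β₀`, `1 ≤ R` with `R + 1 ≤ ⌈β^θ⌉`, every plane `q.1 < q.2` and site `x`:
`|β · kerE^𝟙_{β,(x−R−1,2R+3)}(2 − plane q x) − 3/4| ≤ β^{−θ} + K/R⁴`. [folklore] -/
theorem kerE_one_deficit_threeQuarters_polyWindow {θ : ℝ} (hθ : 0 < θ) (hθ₂ : θ ≤ 1 / 100) :
    ∃ K β₀ : ℝ, 0 ≤ K ∧ ∀ β : ℝ, β₀ ≤ β → ∀ R : ℕ, 1 ≤ R → R + 1 ≤ ⌈β ^ θ⌉₊ → ∀ (q : Fin 4 × Fin 4) (x : Fin 4 → ℤ), q.1 < q.2 →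
      |β * kerE (Matrix.specialUnitaryGroup (Fin 2) ℂ) (fundamentalLatticeRep 2) β (fun k => x k - (R + 1)) (2 * R + 3) 1
            (fun U => 2 - plane (Matrix.specialUnitaryGroup (Fin 2) ℂ) (fundamentalLatticeRep 2) q x U) - 3 / 4| ≤
        β ^ (-θ) + K / (R : ℝ) ^ 4 := by
  obtain ⟨K, hK0, hK⟩ := pow_four_mul_abs_boxDirProjKernel_centre_sub_half_le
  obtain ⟨β₀, hsc⟩ := kerE_one_deficit_semiclassical_polyWindow hθ hθ₂
  refine ⟨3 / 2 * K, β₀, by positivity, fun β hβ R hR1 hR q x hq => ?_⟩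
  have h1 := hsc β hβ R hR q x hq
  have h2 := hK R q hq
  have hR0 : (0 : ℝ) < (R : ℝ) ^ 4 := by
    have : (1 : ℝ) ≤ R := by exact_mod_cast hR1
    positivity
  generalize hC : boxDirProjKernel (R + 1) ((fun _ : Fin 4 => (R : ℤ) + 1), q.1, q.2) ((fun _ : Fin 4 => (R : ℤ) + 1), q.1, q.2) = C at h1 h2
  generalize hE : β * kerE (Matrix.specialUnitaryGroup (Fin 2) ℂ) (fundamentalLatticeRep 2) β (fun k => x k - (R + 1)) (2 * R + 3) 1
      (fun U => 2 - plane (Matrix.specialUnitaryGroup (Fin 2) ℂ) (fundamentalLatticeRep 2) q x U) = E at h1 ⊢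
  have h3 : |C - 1 / 2| ≤ K / (R : ℝ) ^ 4 := by
    rw [le_div_iff₀ hR0, mul_comm]; exact h2
  calc |E - 3 / 4| = |(E - 3 / 2 * C) + 3 / 2 * (C - 1 / 2)| := by ring_nf
    _ ≤ |E - 3 / 2 * C| + |3 / 2 * (C - 1 / 2)| := abs_add_le _ _
    _ ≤ β ^ (-θ) + 3 / 2 * (K / (R : ℝ) ^ 4) := by
        rw [abs_mul, abs_of_pos (by norm_num : (0 : ℝ) < 3 / 2)]
        exact add_le_add h1 (mul_le_mul_of_nonneg_left h3 (by norm_num))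
    _ = β ^ (-θ) + 3 / 2 * K / (R : ℝ) ^ 4 := by ring

/-- **(DR) ON THE POLYNOMIAL WINDOW WITH THE EXPLICIT, PLANE-INDEPENDENT REFERENCE `p(β) = 2 − 3/(4·max β 1)`.** [folklore] -/
theorem dirichletRate_polyWindow_threeQuarters {θ : ℝ} (hθ : 0 < θ) (hθ₂ : θ ≤ 1 / 100) :
    ∃ (A₀ β₁ : ℝ), 0 ≤ A₀ ∧
      ∀ β : ℝ, β₁ ≤ β → ∀ R : ℕ, 1 ≤ R → R + 1 ≤ ⌈β ^ θ⌉₊ →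
        ∀ (q : Fin 4 × Fin 4) (x : Fin 4 → ℤ), q.1 < q.2 →
          (R : ℝ) ^ 4 * |kerE (Matrix.specialUnitaryGroup (Fin 2) ℂ) (fundamentalLatticeRep 2) β (fun k => x k - (R + 1)) (2 * R + 3)
              (1 : LGConfig 4 (Matrix.specialUnitaryGroup (Fin 2) ℂ))
              (plane (Matrix.specialUnitaryGroup (Fin 2) ℂ) (fundamentalLatticeRep 2) q x) - (2 - 3 / (4 * max β 1))| ≤ A₀ := by
  obtain ⟨A₀, P₀, β₁, hA₀, -, h⟩ := dirichletRate_polyWindow hθ hθ₂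
  refine ⟨A₀, β₁, hA₀, fun β hβ R hR1 hR q x hq => ?_⟩
  have h1 := h β hβ R hR1 hR q x hq
  rw [curl_greenTensor_self_eq_half q hq] at h1
  have e : (2 : ℝ) - 3 / 2 * (1 / 2) / max β 1 = 2 - 3 / (4 * max β 1) := by
    have : 0 < max β 1 := lt_of_lt_of_le one_pos (le_max_right _ _)
    field_simp; ring
  rw [e] at h1
  exact h1

end Summit.QuantumFields.YangMills.Cruxes.UVSeamRec.ClassicalResponse.ColdWall

end
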